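import Summits.AtomisticToContinuum.Crystallization.Theorems.FrustratedLawDichotomyCellArith
import Summits.AtomisticToContinuum.Crystallization.Theorems.FrustratedLawDichotomyCellTails
import Summits.AtomisticToContinuum.Crystallization.Theorems.FrustratedLawDichotomyShellMinimum
import Summits.AtomisticToContinuum.Crystallization.Theorems.FrustratedLawDichotomyCoherentFloorHalo

/-!
# FrustratedLawDichotomy · crux `AperiodicFrustratedLawGap` (stmt-AtomisticToContinuum-27623) — CELL-ARITH, the once-per-cell
# numbers: literal tails, the shell minimum (host column) and the half-space columns as EXACT RATIONAL FUNCTIONS with their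
# readings (decomp-a2c hand-1 g53; interface of record critic r1772 (B): «S·debTail/psiTail/linTail/remTail ≤ X», the LOWER
# reading of `shellMin`, class H `halfCol`/`halfEnergyCol` at rational dials)

These closed forms are evaluated a handful of times per K-file (the four truncation tails at the dials of record, one host
number per squared-distance CLASS, the two half-space columns per class-H row), so they are kept EXACT in `ℚ` — a `ℚ`-valued
mirror of each tree definition, a cast identity, and the `⌈S·⌉`/`⌊S·⌋` reading:

* §1 (250) `…CellTails`: `S4Q … S12Q`, `psiTailQ`, `linTailQ`, `A9Q A15Q B9Q B15Q`, `remTailQ`, `debTailQ` with `*_cast` and the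
  readings `le_psiTailHiZ` / `le_linTailHiZ` / `le_remTailHiZ` / `le_debTailHiZ` («S·tail ≤ rdHi S (tailQ …)»);
* §2 (229) `…ShellMinimum`: `phiTQ`, `shellMinQ` (same case split), `phiT_cast`, `shellMin_cast`, ★ `shellMinLoZ S lo hi =
  rdLo S (shellMinQ lo hi)` with `shellMinLoZ_le` («X ≤ S·shellMin lo hi») and `shellMinLoZ_le_phiT` (the (251) `hhost` entry on
  the window; (261)'s `host_of_nearId` takes `hq := X/S` by `…CellArith.div_le_of_reading`);
* §3 class H ((253) `…CellHalo`, door `…CoherentFloorHaloDial`): `halfColQ`, `halfEnergyColQ`, casts and readings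
  `le_halfColHiZ` / `le_halfEnergyColHiZ` at the RATIONAL per-site dials `dH` and plane level `s` (the dial door takes any
  rational lower bound of the clearance, so no monotonicity of `halfCol` is needed — r1767 (A)).

Plain computable `def`s over `ℚ`/`ℤ` (no instance / notation / option); imports `…CellArith`, (250), (229), `…CoherentFloorHalo`; 0 sorry.  Tags: [folklore].
-/

namespace Summit.AtomisticToContinuum.Crystallization.Theorems.FrustratedLawDichotomyCellArithTails

open Summit.AtomisticToContinuum.Crystallization.Theorems.FrustratedLawDichotomyCoherentFloorAlgebra (phiT)
open Summit.AtomisticToContinuum.Crystallization.Theorems.FrustratedLawDichotomyShellMinimum (shellMin shellMin_le_phiT)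
open Summit.AtomisticToContinuum.Crystallization.Theorems.FrustratedLawDichotomyCellTails
  (S4 S5 S6 S10 S11 S12 psiTail linTail A9 A15 B9 B15 remTail debTail)
open Summit.AtomisticToContinuum.Crystallization.Theorems.FrustratedLawDichotomyCoherentFloorHalo (halfCol halfEnergyCol)
open Summit.AtomisticToContinuum.Crystallization.Theorems.FrustratedLawDichotomyCellArith

/-! ## §1 The literal tails of (250) over `ℚ` -/

/-- `S₄` over `ℚ`. [folklore] -/
def S4Q (δ R : ℚ) : ℚ := 3 / 4 * (2 / δ) ^ 3 * R⁻¹ ^ 4 + 36 / 5 * (2 / δ) ^ 2 * R⁻¹ ^ 5 + 1 / 2 * (2 / δ) * R⁻¹ ^ 6 + 2 * R⁻¹ ^ 7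
/-- `S₅` over `ℚ`. [folklore] -/
def S5Q (δ R : ℚ) : ℚ := 3 / 5 * (2 / δ) ^ 3 * R⁻¹ ^ 5 + 7 * (2 / δ) ^ 2 * R⁻¹ ^ 6 + 3 / 7 * (2 / δ) * R⁻¹ ^ 7 + 2 * R⁻¹ ^ 8
/-- `S₆` over `ℚ`. [folklore] -/
def S6Q (δ R : ℚ) : ℚ := 1 / 2 * (2 / δ) ^ 3 * R⁻¹ ^ 6 + 48 / 7 * (2 / δ) ^ 2 * R⁻¹ ^ 7 + 3 / 8 * (2 / δ) * R⁻¹ ^ 8 + 2 * R⁻¹ ^ 9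
/-- `S₁₀` over `ℚ`. [folklore] -/
def S10Q (δ R : ℚ) : ℚ := 3 / 10 * (2 / δ) ^ 3 * R⁻¹ ^ 10 + 72 / 11 * (2 / δ) ^ 2 * R⁻¹ ^ 11 + 1 / 4 * (2 / δ) * R⁻¹ ^ 12 + 2 * R⁻¹ ^ 13
/-- `S₁₁` over `ℚ`. [folklore] -/
def S11Q (δ R : ℚ) : ℚ := 3 / 11 * (2 / δ) ^ 3 * R⁻¹ ^ 11 + 13 / 2 * (2 / δ) ^ 2 * R⁻¹ ^ 12 + 3 / 13 * (2 / δ) * R⁻¹ ^ 13 + 2 * R⁻¹ ^ 14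
/-- `S₁₂` over `ℚ`. [folklore] -/
def S12Q (δ R : ℚ) : ℚ := 1 / 4 * (2 / δ) ^ 3 * R⁻¹ ^ 12 + 84 / 13 * (2 / δ) ^ 2 * R⁻¹ ^ 13 + 3 / 14 * (2 / δ) * R⁻¹ ^ 14 + 2 * R⁻¹ ^ 15
/-- `T0_δ(R)` over `ℚ`. [folklore] -/
def psiTailQ (δ R : ℚ) : ℚ := S4Q δ R + S10Q δ R
/-- `TL_δ(L)` over `ℚ`. [folklore] -/
def linTailQ (δ L : ℚ) : ℚ := 9 * S5Q δ L + 15 * S11Q δ L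
/-- `A₉(q)` over `ℚ`. [folklore] -/
def A9Q (q : ℚ) : ℚ := 10 * (1 - q)⁻¹ ^ 12 * (2 + q) ^ 2 * (1 + q) + 4 * (3 + q)
/-- `A₁₅(q)` over `ℚ`. [folklore] -/
def A15Q (q : ℚ) : ℚ := 28 * (1 - q)⁻¹ ^ 18 * (2 + q) ^ 2 * (1 + q) + 7 * (3 + q)
/-- `B₉(q)` over `ℚ`. [folklore] -/
def B9Q (q : ℚ) : ℚ := 5 / 3 * (1 - q)⁻¹ ^ 12 * (2 + q) ^ 3 + 2 * (2 + q)
/-- `B₁₅(q)` over `ℚ`. [folklore] -/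
def B15Q (q : ℚ) : ℚ := 14 / 3 * (1 - q)⁻¹ ^ 18 * (2 + q) ^ 3 + 7 / 2 * (2 + q)
/-- the remainder-column tail over `ℚ`. [folklore] -/
def remTailQ (δ L τ : ℚ) : ℚ := (2 * τ) ^ 2 * (A9Q (2 * τ / L) * S6Q δ L + A15Q (2 * τ / L) * S12Q δ L)
/-- the root-bond debit tail over `ℚ`. [folklore] -/
def debTailQ (δ L τ : ℚ) : ℚ :=
  τ ^ 2 * (7 / 2 * S5Q δ L + 1 / 2 * S11Q δ L) + τ ^ 3 * (B9Q (τ / L) * S6Q δ L + B15Q (τ / L) * S12Q δ L)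

section Casts

variable (δ R L τ q : ℚ)

/-- cast identity. -/ theorem S4_cast : S4 (δ : ℝ) (R : ℝ) = ((S4Q δ R : ℚ) : ℝ) := by unfold S4 S4Q; push_cast; ring
/-- cast identity. -/ theorem S5_cast : S5 (δ : ℝ) (R : ℝ) = ((S5Q δ R : ℚ) : ℝ) := by unfold S5 S5Q; push_cast; ring
/-- cast identity. -/ theorem S6_cast : S6 (δ : ℝ) (R : ℝ) = ((S6Q δ R : ℚ) : ℝ) := by unfold S6 S6Q; push_cast; ring
/-- cast identity. -/ theorem S10_cast : S10 (δ : ℝ) (R : ℝ) = ((S10Q δ R : ℚ) : ℝ) := by unfold S10 S10Q; push_cast; ring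
/-- cast identity. -/ theorem S11_cast : S11 (δ : ℝ) (R : ℝ) = ((S11Q δ R : ℚ) : ℝ) := by unfold S11 S11Q; push_cast; ring
/-- cast identity. -/ theorem S12_cast : S12 (δ : ℝ) (R : ℝ) = ((S12Q δ R : ℚ) : ℝ) := by unfold S12 S12Q; push_cast; ring
/-- cast identity. -/ theorem A9_cast : A9 (q : ℝ) = ((A9Q q : ℚ) : ℝ) := by unfold A9 A9Q; push_cast; ring
/-- cast identity. -/ theorem A15_cast : A15 (q : ℝ) = ((A15Q q : ℚ) : ℝ) := by unfold A15 A15Q; push_cast; ring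
/-- cast identity. -/ theorem B9_cast : B9 (q : ℝ) = ((B9Q q : ℚ) : ℝ) := by unfold B9 B9Q; push_cast; ring
/-- cast identity. -/ theorem B15_cast : B15 (q : ℝ) = ((B15Q q : ℚ) : ℝ) := by unfold B15 B15Q; push_cast; ring

/-- `T0_δ(R)` at rationals is the cast of `psiTailQ`. [folklore] -/
theorem psiTail_cast : psiTail (δ : ℝ) (R : ℝ) = ((psiTailQ δ R : ℚ) : ℝ) := by
  unfold psiTail psiTailQ; rw [S4_cast, S10_cast]; push_cast; ring

/-- `TL_δ(L)` at rationals is the cast of `linTailQ`. [folklore] -/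
theorem linTail_cast : linTail (δ : ℝ) (L : ℝ) = ((linTailQ δ L : ℚ) : ℝ) := by
  unfold linTail linTailQ; rw [S5_cast, S11_cast]; push_cast; ring

/-- the remainder tail at rationals is the cast of `remTailQ`. [folklore] -/
theorem remTail_cast : remTail (δ : ℝ) (L : ℝ) (τ : ℝ) = ((remTailQ δ L τ : ℚ) : ℝ) := by
  unfold remTail remTailQ
  have e : (2 : ℝ) * (τ : ℝ) / (L : ℝ) = (((2 * τ / L : ℚ)) : ℝ) := by push_cast; ring
  rw [e, A9_cast, A15_cast, S6_cast, S12_cast]; push_cast; ring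

/-- the debit tail at rationals is the cast of `debTailQ`. [folklore] -/
theorem debTail_cast : debTail (δ : ℝ) (L : ℝ) (τ : ℝ) = ((debTailQ δ L τ : ℚ) : ℝ) := by
  unfold debTail debTailQ
  have e : (τ : ℝ) / (L : ℝ) = (((τ / L : ℚ)) : ℝ) := by push_cast; ring
  rw [e, B9_cast, B15_cast, S5_cast, S6_cast, S11_cast, S12_cast]; push_cast; ring

end Casts

section Readings

variable {S : ℤ} (δ R L τ : ℚ)

/-- ★ «S·psiTail δ R ≤ X» with `X = rdHi S (psiTailQ δ R)`. [folklore] -/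
theorem le_psiTailHiZ : S * psiTail (δ : ℝ) (R : ℝ) ≤ ((rdHi S (psiTailQ δ R) : ℤ) : ℝ) := by
  rw [psiTail_cast]; exact le_rdHi S _

/-- ★ «S·linTail δ L ≤ X». [folklore] -/
theorem le_linTailHiZ : S * linTail (δ : ℝ) (L : ℝ) ≤ ((rdHi S (linTailQ δ L) : ℤ) : ℝ) := by
  rw [linTail_cast]; exact le_rdHi S _

/-- ★ «S·remTail δ L τ ≤ X». [folklore] -/
theorem le_remTailHiZ : S * remTail (δ : ℝ) (L : ℝ) (τ : ℝ) ≤ ((rdHi S (remTailQ δ L τ) : ℤ) : ℝ) := by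
  rw [remTail_cast]; exact le_rdHi S _

/-- ★ «S·debTail δ L τ ≤ X». [folklore] -/
theorem le_debTailHiZ : S * debTail (δ : ℝ) (L : ℝ) (τ : ℝ) ≤ ((rdHi S (debTailQ δ L τ) : ℤ) : ℝ) := by
  rw [debTail_cast]; exact le_rdHi S _

end Readings

/-! ## §2 The shell minimum (host column) -/

/-- (225) `phiT` over `ℚ`: `φ(t) = t⁻⁶/12 − t⁻³/6`. [folklore] -/
def phiTQ (t : ℚ) : ℚ := 1 / 12 * t⁻¹ ^ 6 - 1 / 6 * t⁻¹ ^ 3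

/-- (229) `shellMin` over `ℚ` (same case split). [folklore] -/
def shellMinQ (lo hi : ℚ) : ℚ := if hi ≤ 1 then phiTQ hi else if 1 ≤ lo then phiTQ lo else -(1 / 12)

/-- ★ LOWER reading of the shell minimum: `⌊S·shellMinQ lo hi⌋`. [folklore] -/
def shellMinLoZ (S : ℤ) (lo hi : ℚ) : ℤ := rdLo S (shellMinQ lo hi)

/-- `φ` at a rational point is the cast of `phiTQ`. [folklore] -/
theorem phiT_cast (t : ℚ) : phiT (t : ℝ) = ((phiTQ t : ℚ) : ℝ) := by
  unfold phiT phiTQ; push_cast; ring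

/-- `shellMin` at rational endpoints is the cast of `shellMinQ`. [folklore] -/
theorem shellMin_cast (lo hi : ℚ) : shellMin (lo : ℝ) (hi : ℝ) = ((shellMinQ lo hi : ℚ) : ℝ) := by
  unfold shellMin shellMinQ
  by_cases h1 : hi ≤ 1
  · have h1' : (hi : ℝ) ≤ 1 := by exact_mod_cast h1
    rw [if_pos h1', if_pos h1, phiT_cast]
  · have h1' : ¬ (hi : ℝ) ≤ 1 := by exact_mod_cast h1
    rw [if_neg h1', if_neg h1]
    by_cases h2 : 1 ≤ lo
    · have h2' : (1 : ℝ) ≤ lo := by exact_mod_cast h2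
      rw [if_pos h2', if_pos h2, phiT_cast]
    · have h2' : ¬ (1 : ℝ) ≤ lo := by exact_mod_cast h2
      rw [if_neg h2', if_neg h2]; push_cast; ring

/-- ★ `shellMinLoZ S lo hi ≤ S·shellMin lo hi`. [folklore] -/
theorem shellMinLoZ_le (S : ℤ) (lo hi : ℚ) : ((shellMinLoZ S lo hi : ℤ) : ℝ) ≤ S * shellMin (lo : ℝ) (hi : ℝ) := by
  rw [shellMin_cast]; exact rdLo_le S _

/-- ★ THE HOST ENTRY on a window: `0 < lo ≤ t ≤ hi ⇒ shellMinLoZ S lo hi ≤ S·φ(t)` ((229) `shellMin_le_phiT`; `0 ≤ S`). [folklore] -/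
theorem shellMinLoZ_le_phiT {S : ℤ} {lo hi : ℚ} {t : ℝ} (hS : 0 ≤ S) (h0 : 0 < lo) (h1 : (lo : ℝ) ≤ t) (h2 : t ≤ (hi : ℝ)) :
    ((shellMinLoZ S lo hi : ℤ) : ℝ) ≤ S * phiT t :=
  (shellMinLoZ_le S lo hi).trans
    (mul_le_mul_of_nonneg_left (shellMin_le_phiT (by exact_mod_cast h0) h1 h2) (by exact_mod_cast hS))

/-- the real form (261)'s `host_of_nearId` consumes: `hq := shellMinLoZ/S ≤ shellMin lo hi` (`0 < S`). [folklore] -/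
theorem shellMinLoZ_div_le {S : ℤ} (hS : 0 < S) (lo hi : ℚ) :
    ((shellMinLoZ S lo hi : ℤ) : ℝ) / S ≤ shellMin (lo : ℝ) (hi : ℝ) :=
  div_le_of_reading hS (shellMinLoZ_le S lo hi)

/-! ## §3 Class H: the half-space columns at rational dials -/

/-- `halfCol` of `…CoherentFloorHalo` over `ℚ` (same literal). [folklore] -/
def halfColQ (d : ℚ) : ℚ :=
  7 * (4000 / 343 * d⁻¹ ^ 4 / 4 + 2000 / 343 * (63 / 20 - 3 * d) * d⁻¹ ^ 5 / 5 + 600 / 49 * (7 / 10 - d) * d⁻¹ ^ 6 / 6 +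
      2000 / 343 * ((7 / 10 - d) ^ 2 * (d + 7 / 20)) * d⁻¹ ^ 7 / 7) +
    13 * (4000 / 343 * d⁻¹ ^ 10 / 10 + 2000 / 343 * (63 / 20 - 3 * d) * d⁻¹ ^ 11 / 11 + 600 / 49 * (7 / 10 - d) * d⁻¹ ^ 12 / 12 +
      2000 / 343 * ((7 / 10 - d) ^ 2 * (d + 7 / 20)) * d⁻¹ ^ 13 / 13)

/-- `halfEnergyCol` of `…CoherentFloorHalo` over `ℚ` (same literal). [folklore] -/
def halfEnergyColQ (d : ℚ) : ℚ :=
  1 / 6 * (6 * (4000 / 343 * d⁻¹ ^ 3 / 3 + 2000 / 343 * (63 / 20 - 3 * d) * d⁻¹ ^ 4 / 4 + 600 / 49 * (7 / 10 - d) * d⁻¹ ^ 5 / 5 +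
    2000 / 343 * ((7 / 10 - d) ^ 2 * (d + 7 / 20)) * d⁻¹ ^ 6 / 6))

/-- cast identity for `halfCol`. [folklore] -/
theorem halfCol_cast (d : ℚ) : halfCol (d : ℝ) = ((halfColQ d : ℚ) : ℝ) := by
  unfold halfCol halfColQ; push_cast; ring

/-- cast identity for `halfEnergyCol`. [folklore] -/
theorem halfEnergyCol_cast (d : ℚ) : halfEnergyCol (d : ℝ) = ((halfEnergyColQ d : ℚ) : ℝ) := by
  unfold halfEnergyCol halfEnergyColQ; push_cast; ring

/-- ★ «S·halfCol d ≤ X» at a rational dial `d` (`X = rdHi S (halfColQ d)`). [folklore] -/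
theorem le_halfColHiZ (S : ℤ) (d : ℚ) : S * halfCol (d : ℝ) ≤ ((rdHi S (halfColQ d) : ℤ) : ℝ) := by
  rw [halfCol_cast]; exact le_rdHi S _

/-- ★ «S·halfEnergyCol s ≤ X» at a rational plane level `s`. [folklore] -/
theorem le_halfEnergyColHiZ (S : ℤ) (s : ℚ) : S * halfEnergyCol (s : ℝ) ≤ ((rdHi S (halfEnergyColQ s) : ℤ) : ℝ) := by
  rw [halfEnergyCol_cast]; exact le_rdHi S _

end Summit.AtomisticToContinuum.Crystallization.Theorems.FrustratedLawDichotomyCellArithTails
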